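import Literature.AlgebraicGeometry.HodgeTheory.NodalPencilSaturatedRadius
import Literature.AlgebraicGeometry.HodgeTheory.NodalPencilCutoffFlows
import Literature.AlgebraicGeometry.Motives.UniversalHypersurfaceRegularLocusFlowCoeff
import Literature.Geometry.Manifold.IntegralCurveSlab
import Literature.Analysis.Calculus.AutonomousLineComparison
import HarnessLib

/-!
# The orbits of a cut-off shell-tangent lift stay in the invariant set; the pencil coordinate is translated at unit speed

Family `hodge`, layer `Literature/AlgebraicGeometry/HodgeTheory`. Written by the prover seat `hodge-nonav-prover-Bx` (g15, cell
`hodge-nonav`) as a brick of the ODP-ISOTOPY port (memo `PROGRAMME-ODP-ISOTOPY-Bx-g13` §2; Picard–Lefschetz binder hPL₁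
`picardLefschetz_oneNode` of crux K1-B, stmt-HodgeConjecture-19716): the generalisation of the `Orbit` section of prover-Ax's
`CyclicCoverPencilShellInvariance` and of `CyclicCoverPencilFoldHypotheses` (steps A2c(iii)–(v) for the quaternary cyclic pencil
`x₃^p = f₁ + c·x₂^p`) to an ARBITRARY degree `d ≥ 1`, `n + 2` variables, chart `xᵢ ≠ 0` and the monomial pencil direction `xᵢ^d`; the
pencil is encoded by the coefficient vector `b₀` of its nodal member (`NodalPencilSaturatedRadius`: `pencilCoord`, `pencilSlice`,
`satRadius`, `invariantSet`), the node by a Morse chart `Θ` (`NodalPencilShellFields`), the cut-off lift by `cutoffScalar n d i β χ' • X`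
(`NodalPencilCutoffFlows`) for a shell-tangent lift `X` of a coefficient field `W` supported along `e_{xᵢ^d}` (`db(X) = W(b)`, `dρ̃(X) = 0` on
the shell set).

* section `Orbit` — along an integral curve `γ` of `cutoffScalar • X` starting in `A = S ∩ {s₁² < F}`: `orbit_mem_pencilSlice` (`b'`
  conserved), `mfderiv_satRadius_orbit_eq_zero` (the saturated radius is a first integral at the slab points, `supp χ' ⊆ {‖b − b₀‖ < ρK}`,
  `ρK ≤ δ`), `satRadius_orbit_gt` and `orbit_mem_invariantSet` (**`A` is invariant**, via `Geometry/Manifold/IntegralCurveSlab`),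
  `nodeCutoff_orbit_eq_zero`, `cutoffScalar_orbit_eq` (the node cut-off `β`, supported in the Morse ball of radius `s₀ < s₁`, is idle);
* section `Translation` — `regCoeff_orbit_eq_add_single` (`b(γ s) = b₀ + q(s)·e_{xᵢ^d}`, `q = pencilCoord ∘ γ`),
  `hasDerivAt_pencilCoord_orbit` (`q' = v(q)`, `v(z) = χ'(b₀ + z e)·W(b₀ + z e)_{xᵢ^d}`), `pencilCoord_orbit_eq_add` (`q(s) = q(0) + s•u`
  on segments where `‖q(0) + s•u‖ < ρW`, `χ' = 1` and `W_{xᵢ^d} = u` there; `Analysis/Calculus/AutonomousLineComparison`);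
* `fold_hypothesis_of_flow` — **for a flow `θ` of `cutoffScalar • X`: `x ∈ A`, `‖c(x) + s•u‖ < ρW` on `[0, t]` ⇒ `θ(s, x) ∈ A ∧
  c(θ(s, x)) = c(x) + s•u`** — hypotheses `h₁`/`h₂` of `Geometry/Manifold/DiscFoldRotationIsotopy.exists_rotationIsotopy_of_folds`.

Everything is proved; no definitions, no named facts. Honest scope: plumbing of the classical construction of the geometric monodromy of
a pencil near an ordinary double point; nothing here says HC or any rung is proved.

## References

* [ArnoldGuseinzadeVarchenko2012] V. I. Arnold, S. M. Gusein-Zade, A. N. Varchenko, Singularities of Differentiable Maps II (2012),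
  Part I §1.1, §2.1.
* [BrockerJanichIDT1982] T. Bröcker, K. Jänich, Introduction to Differential Topology (1982), (8.12) (flows of lifted constant fields).
-/

noncomputable section

open CategoryTheory AlgebraicGeometry MvPolynomial TopologicalSpace Set Topology Filter
open scoped Manifold ContDiff
open Literature.AlgebraicGeometry.Motives Literature.AlgebraicGeometry.Motives.UniversalHypersurface
open Literature.AlgebraicGeometry.HodgeTheory.UniversalHypersurface Literature.Geometry.ComplexAnalytic Literature.Geometry.Manifold
open Literature.Analysis.Calculus

namespace Literature.AlgebraicGeometry.HodgeTheory

namespace NodalPencil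

section Orbit

variable {n d : ℕ} {i : Fin (n + 2)} (hd : 0 < d)
  {Θ : OpenPartialHomeomorph (Fin (n + 1) → ℂ) (Fin (n + 1) → ℂ)} {R''' R'' : ℝ} {b₀ : DegIndex n d → ℂ} {s₀ r₂ δ s₁ : ℝ}
  (β : (Fin (n + 1) → ℂ) → ℝ) (χ' : (DegIndex n d → ℂ) → ℝ) {W : (DegIndex n d → ℂ) → (DegIndex n d → ℂ)}
  (X' : haveI := locallyOfFiniteType_regularTotal_hom ℂ n d hd
    haveI := smoothOfRelativeDimension_regularTotal_hom ℂ n d hd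
    letI := ComplexPoints.chartedSpace (regularTotal ℂ n d) (n + Fintype.card (DegIndex n d))
    Π Q : ComplexPoints (regularTotal ℂ n d), TangentSpace (𝓡 (2 * (n + Fintype.card (DegIndex n d)))) Q)
  (hXW : haveI := locallyOfFiniteType_regularTotal_hom ℂ n d hd
    haveI := smoothOfRelativeDimension_regularTotal_hom ℂ n d hd
    letI := ComplexPoints.chartedSpace (regularTotal ℂ n d) (n + Fintype.card (DegIndex n d))
    ∀ Q, mfderiv (𝓡 (2 * (n + Fintype.card (DegIndex n d)))) 𝓘(ℝ, DegIndex n d → ℂ) (fun Q' => regCoeff ℂ n d Q') Q (X' Q) =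
      W (regCoeff ℂ n d Q))
  (hW' : ∀ b (m : DegIndex n d), m ≠ regPowIndex n d i → W b m = 0)
  {γ : ℝ → ComplexPoints (regularTotal ℂ n d)}
  (hγ : haveI := locallyOfFiniteType_regularTotal_hom ℂ n d hd
    haveI := smoothOfRelativeDimension_regularTotal_hom ℂ n d hd
    letI := ComplexPoints.chartedSpace (regularTotal ℂ n d) (n + Fintype.card (DegIndex n d))
    IsMIntegralCurve γ (fun Q' => cutoffScalar n d i β χ' Q' • X' Q'))
  (h0 : γ 0 ∈ invariantSet n d i Θ R''' R'' b₀ s₁)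
include hXW hW' hγ h0

/-- **The remaining coefficients are conserved along the orbit: it stays in the pencil slice.** [cite: BrockerJanichIDT1982, (8.12)] -/
theorem orbit_mem_pencilSlice (s : ℝ) : γ s ∈ pencilSlice n d i b₀ := fun m => by
  rw [← h0.1 m]
  exact regCoeff_apply_integralCurve_const n d hd X' (cutoffScalar n d i β χ') hXW (fun b => hW' b m.1 m.2) hγ 0 s

/-- **Along the orbit the coefficient vector is `b₀ + c(γ s)·e_{xᵢ^d}`.** [cite: BrockerJanichIDT1982, (8.12)] -/
theorem regCoeff_orbit_eq_add_single (s : ℝ) :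
    regCoeff ℂ n d (γ s) = b₀ + Pi.single (regPowIndex n d i) (pencilCoord n d i b₀ (γ s)) :=
  regCoeff_eq_add_single_pencilCoord n d i b₀ (orbit_mem_pencilSlice hd β χ' X' hXW hW' hγ h0 s)

variable {ρK : ℝ} (hR : R''' < R'') (hr : r₂ ^ 2 < R''') (φ : (Fin (n + 1) → ℂ) → ℂ)
  (hφ : ∀ y, φ y = regChartCoeffVec n d i
    (Sum.elim (fun m : {m : DegIndex n d // m ≠ regPowIndex n d i} => b₀ m.1) y) (regPowIndex n d i) - b₀ (regPowIndex n d i))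
  (hχK : ∀ b, χ' b ≠ 0 → ‖b - b₀‖ < ρK) (hρδ : ρK ≤ δ)
  (hXK : haveI := locallyOfFiniteType_regularTotal_hom ℂ n d hd
    haveI := smoothOfRelativeDimension_regularTotal_hom ℂ n d hd
    letI := ComplexPoints.chartedSpace (regularTotal ℂ n d) (n + Fintype.card (DegIndex n d))
    ∀ Q ∈ shellSet Θ φ s₀ r₂ δ d i (fun m : {m : DegIndex n d // m ≠ regPowIndex n d i} => b₀ m.1),
      mfderiv (𝓡 (2 * (n + Fintype.card (DegIndex n d)))) 𝓘(ℝ, ℝ)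
        (regChartExtend n d i (fun v => ChartRadius.cutoff Θ R''' R'' (fun j => v (Sum.inr j)))) Q (X' Q) = 0)
include hR hr hφ hχK hρδ hXK

-- the tangent space of `ℝ` is `ℝ` by definition
set_option backward.isDefEq.respectTransparency false in
/-- **The saturated radius is a first integral at every slab point of the orbit** (`supp χ'` has radius `ρK ≤ δ`, the shell parameter).
[cite: ArnoldGuseinzadeVarchenko2012, Part I §1.1] -/
theorem mfderiv_satRadius_orbit_eq_zero (s : ℝ) (hlow : s₀ ^ 2 < satRadius n d i Θ R''' R'' (γ s))
    (hup : satRadius n d i Θ R''' R'' (γ s) < r₂ ^ 2) :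
    haveI := locallyOfFiniteType_regularTotal_hom ℂ n d hd
    haveI := smoothOfRelativeDimension_regularTotal_hom ℂ n d hd
    letI := ComplexPoints.chartedSpace (regularTotal ℂ n d) (n + Fintype.card (DegIndex n d))
    mfderiv (𝓡 (2 * (n + Fintype.card (DegIndex n d)))) 𝓘(ℝ, ℝ) (satRadius n d i Θ R''' R'') (γ s)
      (cutoffScalar n d i β χ' (γ s) • X' (γ s)) = 0 := by
  haveI := locallyOfFiniteType_regularTotal_hom ℂ n d hd
  haveI := smoothOfRelativeDimension_regularTotal_hom ℂ n d hd
  letI := ComplexPoints.chartedSpace (regularTotal ℂ n d) (n + Fintype.card (DegIndex n d))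
  have hS := orbit_mem_pencilSlice hd β χ' X' hXW hW' hγ h0 s
  by_cases hχ : χ' (regCoeff ℂ n d (γ s)) = 0
  · rw [cutoffScalar_eq_zero_of_chi n d i β χ' hχ, zero_smul, map_zero]
  · have hnorm := hχK _ hχ
    rw [norm_regCoeff_sub_eq n d i b₀ hS] at hnorm
    exact mfderiv_satRadius_smul_eq_zero n d i Θ R''' R'' b₀ s₀ r₂ δ hd hR hr φ hφ X' (cutoffScalar n d i β χ') hXK hS
      hlow.le hup.le (hnorm.trans_le hρδ).le

variable (hΘ : ContDiffOn ℝ ∞ Θ Θ.source) (hR'' : {z : Fin (n + 1) → ℂ | ∑ j, ‖z j‖ ^ 2 ≤ R''} ⊆ Θ.target)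
  (hs₀₁ : s₀ ^ 2 < s₁ ^ 2) (hs₁r : s₁ ^ 2 < r₂ ^ 2)
include hΘ hR'' hs₀₁ hs₁r

/-- **Invariance: the orbit stays outside the Morse ball of radius `s₁`** — `s₁² < F(γ s)` for all `s`.
[cite: ArnoldGuseinzadeVarchenko2012, Part I §1.1] -/
theorem satRadius_orbit_gt (s : ℝ) : s₁ ^ 2 < satRadius n d i Θ R''' R'' (γ s) := by
  haveI := locallyOfFiniteType_regularTotal_hom ℂ n d hd
  haveI := smoothOfRelativeDimension_regularTotal_hom ℂ n d hd
  letI := ComplexPoints.chartedSpace (regularTotal ℂ n d) (n + Fintype.card (DegIndex n d))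
  haveI := ComplexPoints.isManifold_real (regularTotal ℂ n d) (n + Fintype.card (DegIndex n d))
  have hF : ContMDiff (𝓡 (2 * (n + Fintype.card (DegIndex n d)))) 𝓘(ℝ, ℝ) 1 (satRadius n d i Θ R''' R'') :=
    (contMDiff_satRadius n d i Θ R''' R'' hd hΘ hR hR'').of_le (by simp)
  exact apply_integralCurve_gt_of_gt_on (I := 𝓡 (2 * (n + Fintype.card (DegIndex n d)))) hF isOpen_univ Set.ordConnected_univ
    (hγ.isMIntegralCurveOn _)
    (fun r _ hlo hhi => mfderiv_satRadius_orbit_eq_zero hd β χ' X' hXW hW' hγ h0 hR hr φ hφ hχK hρδ hXK r hlo hhi)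
    hs₀₁ hs₁r (Set.mem_univ 0) h0.2 (Set.mem_univ s)

/-- **The orbit stays in the invariant set `A`.** [cite: ArnoldGuseinzadeVarchenko2012, Part I §2.1] -/
theorem orbit_mem_invariantSet (s : ℝ) : γ s ∈ invariantSet n d i Θ R''' R'' b₀ s₁ :=
  ⟨orbit_mem_pencilSlice hd β χ' X' hXW hW' hγ h0 s,
    satRadius_orbit_gt hd β χ' X' hXW hW' hγ h0 hR hr φ hφ hχK hρδ hXK hΘ hR'' hs₀₁ hs₁r s⟩

variable (hβ : ∀ y, β y ≠ 0 → y ∈ Θ.source ∧ ∑ j, ‖Θ y j‖ ^ 2 < s₀ ^ 2)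
include hβ

/-- **The node cut-off vanishes along the orbit** (`β` is supported where the Morse radius is `< s₀²`).
[cite: ArnoldGuseinzadeVarchenko2012, Part I §2.1] -/
theorem nodeCutoff_orbit_eq_zero (s : ℝ) :
    regChartExtend n d i (fun v => β (fun j => v (Sum.inr j))) (γ s) = 0 := by
  by_cases hQ : γ s ∈ regChartDom n d i
  · rw [regChartExtend_of_mem n d i _ hQ]
    by_contra hne
    obtain ⟨hy, hlt⟩ := hβ _ hne
    have hF := satRadius_eq_of_le n d i Θ R''' R'' hR hQ hy (hlt.le.trans (hs₀₁.le.trans (hs₁r.le.trans hr.le)))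
    have hgt := satRadius_orbit_gt hd β χ' X' hXW hW' hγ h0 hR hr φ hφ hχK hρδ hXK hΘ hR'' hs₀₁ hs₁r s
    rw [hF] at hgt
    linarith
  · exact regChartExtend_of_not_mem n d i _ hQ

/-- **Hence the cut-off scalar along the orbit is `χ'(b(γ s))`.** [cite: ArnoldGuseinzadeVarchenko2012, Part I §2.1] -/
theorem cutoffScalar_orbit_eq (s : ℝ) : cutoffScalar n d i β χ' (γ s) = χ' (regCoeff ℂ n d (γ s)) :=
  cutoffScalar_eq_of n d i β χ'
    (nodeCutoff_orbit_eq_zero hd β χ' X' hXW hW' hγ h0 hR hr φ hφ hχK hρδ hXK hΘ hR'' hs₀₁ hs₁r hβ s)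

/-! ### The pencil coordinate along the orbit -/

-- tangent spaces of model vector spaces are the spaces themselves
set_option backward.isDefEq.respectTransparency false in
/-- **The pencil coordinate solves `q' = v(q)` along the orbit**, `v(z) = χ'(b₀ + z e)·W(b₀ + z e)_{xᵢ^d}`
(`b₀ + z e = b₀ + single xᵢ^d z`). [cite: BrockerJanichIDT1982, (8.12)] -/
theorem hasDerivAt_pencilCoord_orbit (s : ℝ) :
    HasDerivAt (fun s => pencilCoord n d i b₀ (γ s))
      ((fun z : ℂ => (χ' (b₀ + Pi.single (regPowIndex n d i) z) : ℂ) *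
          W (b₀ + Pi.single (regPowIndex n d i) z) (regPowIndex n d i))
        (pencilCoord n d i b₀ (γ s))) s := by
  haveI := locallyOfFiniteType_regularTotal_hom ℂ n d hd
  haveI := smoothOfRelativeDimension_regularTotal_hom ℂ n d hd
  letI := ComplexPoints.chartedSpace (regularTotal ℂ n d) (n + Fintype.card (DegIndex n d))
  haveI := ComplexPoints.isManifold_real (regularTotal ℂ n d) (n + Fintype.card (DegIndex n d))
  -- the coordinate function `g Q = b_{xᵢ^d}(Q)` is `C¹`
  have hg : ContMDiff (𝓡 (2 * (n + Fintype.card (DegIndex n d)))) 𝓘(ℝ, ℂ) 1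
      (fun Q' : ComplexPoints (regularTotal ℂ n d) => regCoeff ℂ n d Q' (regPowIndex n d i)) := by
    have h' : ContMDiff (𝓡 (2 * (n + Fintype.card (DegIndex n d)))) 𝓘(ℝ, DegIndex n d → ℂ) ∞
        (fun Q' : ComplexPoints (regularTotal ℂ n d) => regCoeff ℂ n d Q') :=
      fun Q => contMDiffAt_regCoeff n d hd Q
    have h : ContMDiff (𝓡 (2 * (n + Fintype.card (DegIndex n d)))) 𝓘(ℝ, DegIndex n d → ℂ) 1
        (fun Q' : ComplexPoints (regularTotal ℂ n d) => regCoeff ℂ n d Q') :=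
      h'.of_le (by exact_mod_cast le_top)
    exact (ContinuousLinearMap.proj (R := ℝ) (regPowIndex n d i) : (DegIndex n d → ℂ) →L[ℝ] ℂ).contMDiff.comp h
  -- chain rule along the integral curve
  have h1 : HasMFDerivAt 𝓘(ℝ, ℝ) (𝓡 (2 * (n + Fintype.card (DegIndex n d)))) γ s
      ((1 : ℝ →L[ℝ] ℝ).smulRight (cutoffScalar n d i β χ' (γ s) • X' (γ s))) := hγ s
  have h2 : HasMFDerivAt (𝓡 (2 * (n + Fintype.card (DegIndex n d)))) 𝓘(ℝ, ℂ)
      (fun Q' : ComplexPoints (regularTotal ℂ n d) => regCoeff ℂ n d Q' (regPowIndex n d i)) (γ s)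
      (mfderiv (𝓡 (2 * (n + Fintype.card (DegIndex n d)))) 𝓘(ℝ, ℂ)
        (fun Q' : ComplexPoints (regularTotal ℂ n d) => regCoeff ℂ n d Q' (regPowIndex n d i)) (γ s)) :=
    (hg.mdifferentiableAt one_ne_zero).hasMFDerivAt
  have h3 := h2.comp s h1
  rw [hasMFDerivAt_iff_hasFDerivAt] at h3
  have h4 := h3.hasDerivAt
  have hval : ((mfderiv (𝓡 (2 * (n + Fintype.card (DegIndex n d)))) 𝓘(ℝ, ℂ)
      (fun Q' : ComplexPoints (regularTotal ℂ n d) => regCoeff ℂ n d Q' (regPowIndex n d i)) (γ s)).comp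
        ((1 : ℝ →L[ℝ] ℝ).smulRight (cutoffScalar n d i β χ' (γ s) • X' (γ s)))) (1 : ℝ) =
      (χ' (regCoeff ℂ n d (γ s)) : ℂ) * W (regCoeff ℂ n d (γ s)) (regPowIndex n d i) := by
    rw [ContinuousLinearMap.comp_apply, ContinuousLinearMap.smulRight_apply, one_apply_eq_self, one_smul,
      mfderiv_regCoeff_apply n d hd, mfderiv_regCoeff_smul n d hd X' (cutoffScalar n d i β χ') hXW,
      cutoffScalar_orbit_eq hd β χ' X' hXW hW' hγ h0 hR hr φ hφ hχK hρδ hXK hΘ hR'' hs₀₁ hs₁r hβ s, Pi.smul_apply,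
      Complex.real_smul]
  have h5 := h4.congr_deriv hval
  -- `pencilCoord = g − const`
  have h6 := h5.sub_const (b₀ (regPowIndex n d i))
  have hb := regCoeff_orbit_eq_add_single hd β χ' X' hXW hW' hγ h0 s
  refine (h6.congr_of_eventuallyEq (Eventually.of_forall fun s' => by simp [pencilCoord, Function.comp])).congr_deriv ?_
  simp only [hb]

variable {u : ℂ} {ρW : ℝ} {Kv : NNReal}
  (hχ1 : ∀ b, ‖b - b₀‖ < ρW → χ' b = 1) (hWu : ∀ b, ‖b - b₀‖ < ρW → W b (regPowIndex n d i) = u)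
  (hv : LipschitzWith Kv (fun z : ℂ => (χ' (b₀ + Pi.single (regPowIndex n d i) z) : ℂ) *
    W (b₀ + Pi.single (regPowIndex n d i) z) (regPowIndex n d i)))
include hχ1 hWu hv

/-- **The pencil coordinate is translated: `q(s) = q(0) + s•u`** on every segment `[0, t]` with `‖q(0) + s•u‖ < ρW` on it (`χ' = 1` and
`W_{xᵢ^d} = u` on `‖b − b₀‖ < ρW`). [cite: BrockerJanichIDT1982, (8.12)] -/
theorem pencilCoord_orbit_eq_add {t : ℝ} (hseg : ∀ s ∈ uIcc 0 t, ‖pencilCoord n d i b₀ (γ 0) + s • u‖ < ρW) {s : ℝ}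
    (hs : s ∈ uIcc 0 t) :
    pencilCoord n d i b₀ (γ s) = pencilCoord n d i b₀ (γ 0) + s • u := by
  classical
  refine eq_add_smul_of_hasDerivAt_of_eqOn_ball (q := fun s => pencilCoord n d i b₀ (γ s)) hv (ρ := ρW) ?_
    (fun s => hasDerivAt_pencilCoord_orbit hd β χ' X' hXW hW' hγ h0 hR hr φ hφ hχK hρδ hXK hΘ hR'' hs₀₁ hs₁r hβ s) hseg hs
  intro z hz
  have hnorm : ‖(b₀ + Pi.single (regPowIndex n d i) z) - b₀‖ < ρW := by
    rw [add_sub_cancel_left, Pi.norm_single]; exact hz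
  simp only [hχ1 _ hnorm, hWu _ hnorm, Complex.ofReal_one, one_mul]

end Orbit

/-- **The fold hypotheses for a flow.** Let `θ` be a map with `θ(0, x) = x` whose curves `s ↦ θ(s, x)` are integral curves of the cut-off
lift `cutoffScalar n d i β χ' • X` (as produced by `NodalPencilCutoffFlows.exists_cutoff_globalFlow`), under the hypotheses of section
`Orbit`. Then for `x ∈ A` and `t` with `‖c(x) + s•u‖ < ρW` for all `s ∈ [0, t]`: `θ(s, x) ∈ A` and `c(θ(s, x)) = c(x) + s•u` for all
`s ∈ [0, t]` — hypotheses `h₁`/`h₂` of `Geometry/Manifold/DiscFoldRotationIsotopy.exists_rotationIsotopy_of_folds`.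
[cite: BrockerJanichIDT1982, (8.12)] [cite: ArnoldGuseinzadeVarchenko2012, Part I §2.1] -/
theorem fold_hypothesis_of_flow {n d : ℕ} {i : Fin (n + 2)} (hd : 0 < d)
    {Θ : OpenPartialHomeomorph (Fin (n + 1) → ℂ) (Fin (n + 1) → ℂ)} {R''' R'' : ℝ} {b₀ : DegIndex n d → ℂ} {s₀ r₂ δ s₁ : ℝ}
    (β : (Fin (n + 1) → ℂ) → ℝ) (χ' : (DegIndex n d → ℂ) → ℝ) {W : (DegIndex n d → ℂ) → (DegIndex n d → ℂ)}
    (X' : haveI := locallyOfFiniteType_regularTotal_hom ℂ n d hd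
      haveI := smoothOfRelativeDimension_regularTotal_hom ℂ n d hd
      letI := ComplexPoints.chartedSpace (regularTotal ℂ n d) (n + Fintype.card (DegIndex n d))
      Π Q : ComplexPoints (regularTotal ℂ n d), TangentSpace (𝓡 (2 * (n + Fintype.card (DegIndex n d)))) Q)
    (hXW : haveI := locallyOfFiniteType_regularTotal_hom ℂ n d hd
      haveI := smoothOfRelativeDimension_regularTotal_hom ℂ n d hd
      letI := ComplexPoints.chartedSpace (regularTotal ℂ n d) (n + Fintype.card (DegIndex n d))
      ∀ Q, mfderiv (𝓡 (2 * (n + Fintype.card (DegIndex n d)))) 𝓘(ℝ, DegIndex n d → ℂ) (fun Q' => regCoeff ℂ n d Q') Q (X' Q) =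
        W (regCoeff ℂ n d Q))
    (hW' : ∀ b (m : DegIndex n d), m ≠ regPowIndex n d i → W b m = 0)
    {θ : ℝ × ComplexPoints (regularTotal ℂ n d) → ComplexPoints (regularTotal ℂ n d)} (hθ0 : ∀ Q, θ (0, Q) = Q)
    (hθ : haveI := locallyOfFiniteType_regularTotal_hom ℂ n d hd
      haveI := smoothOfRelativeDimension_regularTotal_hom ℂ n d hd
      letI := ComplexPoints.chartedSpace (regularTotal ℂ n d) (n + Fintype.card (DegIndex n d))
      ∀ Q, IsMIntegralCurve (fun s => θ (s, Q)) (fun Q' => cutoffScalar n d i β χ' Q' • X' Q'))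
    {ρK : ℝ} (hR : R''' < R'') (hr : r₂ ^ 2 < R''') (φ : (Fin (n + 1) → ℂ) → ℂ)
    (hφ : ∀ y, φ y = regChartCoeffVec n d i
      (Sum.elim (fun m : {m : DegIndex n d // m ≠ regPowIndex n d i} => b₀ m.1) y) (regPowIndex n d i) - b₀ (regPowIndex n d i))
    (hχK : ∀ b, χ' b ≠ 0 → ‖b - b₀‖ < ρK) (hρδ : ρK ≤ δ)
    (hXK : haveI := locallyOfFiniteType_regularTotal_hom ℂ n d hd
      haveI := smoothOfRelativeDimension_regularTotal_hom ℂ n d hd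
      letI := ComplexPoints.chartedSpace (regularTotal ℂ n d) (n + Fintype.card (DegIndex n d))
      ∀ Q ∈ shellSet Θ φ s₀ r₂ δ d i (fun m : {m : DegIndex n d // m ≠ regPowIndex n d i} => b₀ m.1),
        mfderiv (𝓡 (2 * (n + Fintype.card (DegIndex n d)))) 𝓘(ℝ, ℝ)
          (regChartExtend n d i (fun v => ChartRadius.cutoff Θ R''' R'' (fun j => v (Sum.inr j)))) Q (X' Q) = 0)
    (hΘ : ContDiffOn ℝ ∞ Θ Θ.source) (hR'' : {z : Fin (n + 1) → ℂ | ∑ j, ‖z j‖ ^ 2 ≤ R''} ⊆ Θ.target)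
    (hs₀₁ : s₀ ^ 2 < s₁ ^ 2) (hs₁r : s₁ ^ 2 < r₂ ^ 2)
    (hβ : ∀ y, β y ≠ 0 → y ∈ Θ.source ∧ ∑ j, ‖Θ y j‖ ^ 2 < s₀ ^ 2)
    {u : ℂ} {ρW : ℝ} {Kv : NNReal}
    (hχ1 : ∀ b, ‖b - b₀‖ < ρW → χ' b = 1) (hWu : ∀ b, ‖b - b₀‖ < ρW → W b (regPowIndex n d i) = u)
    (hv : LipschitzWith Kv (fun z : ℂ => (χ' (b₀ + Pi.single (regPowIndex n d i) z) : ℂ) *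
      W (b₀ + Pi.single (regPowIndex n d i) z) (regPowIndex n d i)))
    {x : ComplexPoints (regularTotal ℂ n d)} (hx : x ∈ invariantSet n d i Θ R''' R'' b₀ s₁) {t : ℝ}
    (hseg : ∀ s ∈ uIcc 0 t, ‖pencilCoord n d i b₀ x + s • u‖ < ρW) {s : ℝ} (hs : s ∈ uIcc 0 t) :
    θ (s, x) ∈ invariantSet n d i Θ R''' R'' b₀ s₁ ∧ pencilCoord n d i b₀ (θ (s, x)) = pencilCoord n d i b₀ x + s • u := by
  have h0 : (fun s => θ (s, x)) 0 ∈ invariantSet n d i Θ R''' R'' b₀ s₁ := by simpa [hθ0 x] using hx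
  refine ⟨orbit_mem_invariantSet hd β χ' X' hXW hW' (hθ x) h0 hR hr φ hφ hχK hρδ hXK hΘ hR'' hs₀₁ hs₁r s, ?_⟩
  have hseg' : ∀ s ∈ uIcc 0 t, ‖pencilCoord n d i b₀ ((fun s => θ (s, x)) 0) + s • u‖ < ρW := by
    simpa [hθ0 x] using hseg
  have h := pencilCoord_orbit_eq_add hd β χ' X' hXW hW' (hθ x) h0 hR hr φ hφ hχK hρδ hXK hΘ hR'' hs₀₁ hs₁r hβ hχ1 hWu hv
    hseg' hs
  simpa [hθ0 x] using h

end NodalPencil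

end Literature.AlgebraicGeometry.HodgeTheory

end
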